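import Summits.QuantumFields.YangMills.Theorems.BalabanUVNodesN15KingModelFullPropagatorRiemann

/-!
# BalabanUVNodes ∕ N15 — THE KING MODEL, PART 11a: THE WEIGHTED ROW-UNIFORM RIEMANN MASS OF KING'S FULL `A = 0` FLUCTUATION PROPAGATOR —
# `N^{−(d+1)}·Σ_y |G^η_K(x, y)|·e^{+δ′|B(x) − B(y)|_M} ≤ C` for every weight rate `0 ≤ δ′ ≤ δ₁`, uniformly in `K`, the volume and the mass
# (Track A, DAG node N15 = NE2; FAN-OUT v1.1 §N15 s3 «KING-MODEL RUNG»)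

HONEST FRAMING.  Count-neutral kernel bookkeeping (cell `pub-ymgap`, seat `pub-ymgap-dag-n15-d` g8; `--supports stmt-QuantumFields-20292
--as helper` = K3⁗ `SpineGivenEndpointR13Sep`; lineage K3 19676 → K3′ 19908 → K3‴ 19912).  TEMPLATE LITERATURE, `A = 0`: C. King's scalar
U(1)-Higgs MODEL on finite tori ([King1986] §2.2 p. 653 (2.13)–(2.17), p. 654 (2.20), Theorem 3.3 p. 658, §4 p. 675 (4.41)–(4.44)), NOT Bałaban's
covariant objects; NE2⁺ is NOT PRINTED for those and not proved here; NOT a node discharge; nothing continuum ∕ ℝ⁴ ∕ OS ∕ mass-gap ∕ Clay.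
0 `sorry`, 0 `def`, standard axioms.
THE POINT.  Part 10a bounded the UNWEIGHTED Riemann mass `N^{−(d+1)}Σ_y|G^η_K(x, y)|` of King's fluctuation propagator
`G(K, M, m²) = King1986.Torus.constrainedProp (L^K) M (aK a L K) ((L^K)²) m²` uniformly in `K`; part 10b's ℓ^∞ Neumann step then bounded the
dressed minimiser `ℋ_w` in SUP norm only (10b HONEST SCOPE (ii)).  An exponentially WEIGHTED mass `Σ_y N^{−(d+1)}|G(x, y)|e^{+δ′|B(x) − B(y)|}`
turns the same Neumann step into a weighted one and gives the DECAY of `ℋ_w` (part 11c: King's Theorem 3.3 (3.7) shape for the dressed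
minimiser).  THIS FILE proves the weighted mass bound by the peel induction of parts O-a∕10a, with one twist: read one level down, the unit-block
distance grows by the factor `L` (n15-e's `mul_tdistT_blockOf_le`), so the weight `e^{δ′·D}` is at most `e^{δ′}·e^{(δ′∕L)·D_sub}` — the weight
RATE seen by the sub-propagator is `δ′∕L ≤ δ′`.  Hence the induction carries the quantifier `∀ δ′ ∈ [0, δ₁]` INSIDE, pays `e^{δ₁} ≤ 3` per level
against the `L^{−2} ≤ 1∕9` of the peel (odd `L ≥ 3`), absorbs the weight into the slice decay (`κ − δ₁ ≥ κ∕2`) and at the bottom into [Ba 4]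
(1.10) (`δ_b − δ₁ ≥ δ_b∕2`):
* §1 `three_le_of_odd`, **`weight_peel_le`** (`δ′·D ≤ (δ′∕L)·D_sub + δ₁` from `L·D ≤ D_sub + (L − 1)`), `abs_mul_exp_le_of_decay`
  (a kernel with decay `κ` times a weight of rate `≤ κ∕2` decays at `κ∕2`);
* §2 ★★ **`fullProp_riemannMassW_unif`** — `∃ δ₁ C > 0` (functions of `d, L, a, m₀²`): for EVERY `0 ≤ δ′ ≤ δ₁`, every `K ≥ 1` (any spelling
  `N = L^K`), every cube `M_μ = 2L^e`, every `0 < m² ≤ m₀²` and every fine `x`:  `N^{−(d+1)}·Σ_y |G^η_K(x, y)|·e^{δ′|B(x) − B(y)|_M} ≤ C`.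
HONEST SCOPE.  (i) `A = 0`, periodic b.c., odd `L ≥ 3`, `0 < m² ≤ m₀²`, cubes `2L^e`; (ii) lattice units of the level-`K` lattice; (iii) `K ≥ 1`;
(iv) a (2.17)-summed bookkeeping statement, not a printed proposition of [King1986]; (v) nothing here is Bałaban's `G_k(U)`; not a discharge.
Locators: [King1986] C. King, CMP **102** (1986) 649–677: (2.13)–(2.17) p. 653, (2.20) p. 654, Theorem 3.3 (3.7) p. 658, Prop. 3.7 (3.64) p. 663,
(4.41)–(4.44) p. 675; [Ba 4] = [Balaban1983RegularityDecay] Theorem (1.10) p. 573.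
-/

noncomputable section

namespace Summit.QuantumFields.YangMills.BalabanUVNodes.N15.KingModel

open Real Finset Matrix
open Literature.MathematicalPhysics.QuantumFieldTheory.Balaban1983to89 (Params)
open Literature.MathematicalPhysics.QuantumFieldTheory.Balaban1983to89.B4Sect5Proof (latticeConst latticeConst_nonneg)
open Literature.MathematicalPhysics.QuantumFieldTheory.Balaban1983to89.B5Prop11Plancherel (Tor fine)
open Literature.MathematicalPhysics.QuantumFieldTheory.King1986 (aK aK_pos)
open Literature.MathematicalPhysics.QuantumFieldTheory.King1986.Torus (constrainedProp flatten blockOf tdistT site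
  blockOf_flatten tdistT_nonneg tdistT_sumBound constrainedProp_decay_blocks_unif)
open Summit.QuantumFields.YangMills.BalabanUVNodes.N15KingModelRung.Curved (KSliceIdx ksM ksU ksSlice mul_tdistT_blockOf_le
  fullProp_peel_abs_le ksSlice_decay_unif)

variable {d : ℕ}

/-! ## §1 Small facts: `L ≥ 3`, the weight under one peel, a weighted decay -/

section Facts

/-- An odd `L ≥ 2` is at least `3`. [folklore] -/
theorem three_le_of_odd {L : ℕ} (hLodd : Odd L) (hL : 2 ≤ L) : 3 ≤ L := by
  obtain ⟨m, hm⟩ := hLodd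
  omega

/-- **THE WEIGHT UNDER ONE PEEL**: if block distances grow as `L·D ≤ D_sub + (L − 1)` (n15-e's `mul_tdistT_blockOf_le`), then for
`0 ≤ δ′ ≤ δ₁` and `L ≥ 1`, `δ′·D ≤ (δ′∕L)·D_sub + δ₁` — the weight rate read one level down is `δ′∕L`. [cite: King1986, (2.10) p.653, Prop. 3.7 (3.64) p.663] -/
theorem weight_peel_le {L D Dsub δ' δ₁ : ℝ} (hL : 1 ≤ L) (hδ0 : 0 ≤ δ') (hδ1 : δ' ≤ δ₁)
    (hgrow : L * D ≤ Dsub + (L - 1)) : δ' * D ≤ δ' / L * Dsub + δ₁ := by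
  have hL0 : 0 < L := by linarith
  have h1 : δ' * D = δ' / L * (L * D) := by field_simp
  have h2 : δ' / L * (L * D) ≤ δ' / L * (Dsub + (L - 1)) := mul_le_mul_of_nonneg_left hgrow (div_nonneg hδ0 hL0.le)
  have h3 : δ' / L * (L - 1) ≤ δ' := by
    rw [div_mul_eq_mul_div, div_le_iff₀ hL0]
    nlinarith
  calc δ' * D = δ' / L * (L * D) := h1
    _ ≤ δ' / L * Dsub + δ' / L * (L - 1) := by rw [← mul_add]; exact h2
    _ ≤ δ' / L * Dsub + δ₁ := by linarith

/-- A kernel bounded by `c·e^{−κt}` times a weight `e^{ρt}` with `ρ ≤ κ∕2`, `t ≥ 0`, is bounded by `c·e^{−(κ∕2)t}`. [folklore] -/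
theorem abs_mul_exp_le_of_decay {A c κ ρ t : ℝ} (hc : 0 ≤ c) (hρ : ρ ≤ κ / 2) (ht : 0 ≤ t) (hA : |A| ≤ c * Real.exp (-(κ * t))) :
    |A * Real.exp (ρ * t)| ≤ c * Real.exp (-(κ / 2 * t)) := by
  rw [abs_mul, abs_of_pos (Real.exp_pos _)]
  calc |A| * Real.exp (ρ * t) ≤ c * Real.exp (-(κ * t)) * Real.exp (ρ * t) :=
        mul_le_mul_of_nonneg_right hA (Real.exp_pos _).le
    _ = c * Real.exp (-(κ * t) + ρ * t) := by rw [Real.exp_add]; ring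
    _ ≤ c * Real.exp (-(κ / 2 * t)) := mul_le_mul_of_nonneg_left (Real.exp_le_exp.mpr (by nlinarith)) hc

end Facts

/-! ## §2 The weighted Riemann mass, uniformly in the number of levels -/

section MassW

variable (L : ℕ) [NeZero L]

/-- **THE WEIGHTED ROW-UNIFORM RIEMANN MASS OF KING'S FULL `A = 0` FLUCTUATION PROPAGATOR IS BOUNDED UNIFORMLY IN THE NUMBER OF LEVELS**:
for odd `L ≥ 3`, `a > 0` and a mass cap `m₀² ≥ 0` there are `δ₁, C > 0` (functions of `d, L, a, m₀²`) such that for EVERY weight rate `0 ≤ δ′ ≤ δ₁`,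
every `K ≥ 1` (any spelling `N = L^K`), every cube `M_μ = 2L^e`, every `0 < m² ≤ m₀²` and every fine `x`:
`N^{−(d+1)}·Σ_y |G^η_K(x, y)|·e^{δ′·|B(x) − B(y)|_M} ≤ C` (`G^η_K = King1986.Torus.constrainedProp (L^K) M (aK a L K) ((L^K)²) m²`).  Induction on `K`
with the weight rate quantified inside (one peel divides it by `L`): `M_{δ′}(K+1) ≤ L^{−2}e^{δ₁}·(M_{δ′∕L}(K) + C_S·K(κ∕2)) ≤ (1∕3)(C + C_SK(κ∕2)) ≤ C`.
[cite: King1986, (2.13)–(2.17) p.653, (2.20) p.654, Theorem 3.3 (3.7) p.658, (4.41)–(4.44) p.675; Balaban1983RegularityDecay, Theorem (1.10) p.573] -/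
theorem fullProp_riemannMassW_unif (hLodd : Odd L) (hL : 2 ≤ L) {a : ℝ} (ha : 0 < a) {m0sq : ℝ} (hm0 : 0 ≤ m0sq) :
    ∃ δ₁ C : ℝ, 0 < δ₁ ∧ 0 < C ∧ ∀ (K : ℕ), 1 ≤ K → ∀ (δ' : ℝ), 0 ≤ δ' → δ' ≤ δ₁ → ∀ (N : ℕ) [NeZero N], N = L ^ K →
      ∀ (e : ℕ) (M : Fin (d + 1) → ℕ) [∀ μ, NeZero (M μ)], (∀ μ, M μ = 2 * L ^ e) →
      ∀ (msq : ℝ), 0 < msq → msq ≤ m0sq →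
      ∀ x : Tor (fine N M),
        (((N : ℕ) : ℝ) ^ (d + 1))⁻¹ * ∑ y, |constrainedProp N M (aK a L K) (((N : ℕ) : ℝ) ^ 2) msq x y|
            * Real.exp (δ' * tdistT M (blockOf N M x) (blockOf N M y)) ≤ C := by
  have hL1 : 1 < L := by omega
  have hL3 : 3 ≤ L := three_le_of_odd hLodd hL
  have hL0 : (0 : ℝ) < L := by exact_mod_cast (show 0 < L by omega)
  have hL1r : (1 : ℝ) ≤ L := by exact_mod_cast hL1.le
  have hL9 : (9 : ℝ) ≤ (L : ℝ) ^ 2 := by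
    have : (3 : ℝ) ≤ L := by exact_mod_cast hL3
    nlinarith
  obtain ⟨δb, cb, hδb, hcb, Hb⟩ := constrainedProp_decay_blocks_unif (d + 1) L (by omega) ⟨hLodd, hL1⟩ ha hm0
  obtain ⟨Cs, κ, hCs, hκ, Hs⟩ := ksSlice_decay_unif (d := d) L hLodd hL ha hm0
  have hKb := latticeConst_nonneg (d + 1) (half_pos hδb).le
  have hKκ := latticeConst_nonneg (d + 1) (half_pos hκ).le
  -- the weight window `δ₁ = min(1, δ_b∕2, κ∕2)` and the constant
  set δ₁ : ℝ := min (min 1 (δb / 2)) (κ / 2) with hδ₁def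
  have hδ₁ : 0 < δ₁ := lt_min (lt_min one_pos (half_pos hδb)) (half_pos hκ)
  have hδ₁1 : δ₁ ≤ 1 := (min_le_left _ _).trans (min_le_left _ _)
  have hδ₁b : δ₁ ≤ δb / 2 := (min_le_left _ _).trans (min_le_right _ _)
  have hδ₁κ : δ₁ ≤ κ / 2 := min_le_right _ _
  set B₀ : ℝ := (L : ℝ) ^ (d + 1) * cb * latticeConst (d + 1) (δb / 2) with hB₀def
  have hB₀ : 0 ≤ B₀ := by positivity
  set C : ℝ := B₀ + Cs * latticeConst (d + 1) (κ / 2) + 1 with hCdef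
  have hC : 0 < C := by positivity
  refine ⟨δ₁, C, hδ₁, hC, ?_⟩
  intro K hK
  induction K, hK using Nat.le_induction with
  | base =>
    intro δ' hδ0 hδ1 N _ hN e M _ hM msq hmsq hcap x
    subst hN
    set P : Params := ⟨d + 1, L, e, 1, by omega, ⟨hLodd, hL1⟩⟩ with hPdef
    have hMK : ∀ μ, M μ = P.sitesPerDir P.K := fun μ => by
      rw [hM μ]
      simp [hPdef, Params.sitesPerDir]
    have hpt : ∀ y, |constrainedProp (L ^ 1) M (aK a L 1) (((L ^ 1 : ℕ) : ℝ) ^ 2) msq x y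
          * Real.exp (δ' * tdistT M (blockOf (L ^ 1) M x) (blockOf (L ^ 1) M y))|
        ≤ (L : ℝ) ^ (d + 1) * cb * Real.exp (-(δb / 2 * tdistT M (blockOf (L ^ 1) M x) (blockOf (L ^ 1) M y))) := by
      intro y
      have h := Hb P rfl rfl le_rfl msq hmsq.le hcap M hMK (L ^ 1) rfl x y
      have hcast : (((L ^ 1 : ℕ) : ℝ)) ^ P.d * cb = (L : ℝ) ^ (d + 1) * cb := by simp [hPdef]
      rw [hcast] at h
      exact abs_mul_exp_le_of_decay (by positivity) (hδ1.trans hδ₁b) (tdistT_nonneg _ _ _) h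
    calc (((L ^ 1 : ℕ) : ℝ) ^ (d + 1))⁻¹ * ∑ y, |constrainedProp (L ^ 1) M (aK a L 1) (((L ^ 1 : ℕ) : ℝ) ^ 2) msq x y|
            * Real.exp (δ' * tdistT M (blockOf (L ^ 1) M x) (blockOf (L ^ 1) M y))
        = (((L ^ 1 : ℕ) : ℝ) ^ (d + 1))⁻¹ * ∑ y, |constrainedProp (L ^ 1) M (aK a L 1) (((L ^ 1 : ℕ) : ℝ) ^ 2) msq x y
            * Real.exp (δ' * tdistT M (blockOf (L ^ 1) M x) (blockOf (L ^ 1) M y))| := by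
          refine congrArg _ (sum_congr rfl fun y _ => ?_)
          rw [abs_mul, abs_of_pos (Real.exp_pos _)]
      _ ≤ (L : ℝ) ^ (d + 1) * cb * latticeConst (d + 1) (δb / 2) :=
          riemannSum_le_of_decay (L ^ 1) M (half_pos hδb) (by positivity) (blockOf (L ^ 1) M x) hpt
      _ ≤ C := by rw [hCdef]; linarith [mul_nonneg hCs.le hKκ]
  | succ K hK IH =>
    intro δ' hδ0 hδ1 N _ hN e M _ hM msq hmsq hcap x'
    subst hN
    obtain rfl : M = fun _ => 2 * L ^ e := funext hM
    set i : KSliceIdx d := ⟨e, K, hK, 1, le_rfl, 0, Nat.zero_le e, 1, le_rfl⟩ with hidef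
    obtain ⟨x, rfl⟩ := (flatten (L ^ K) L (ksM L i)).surjective x'
    have hL2pos : (0 : ℝ) < (L : ℝ) ^ 2 := by positivity
    have hm2 : 0 < msq / (L : ℝ) ^ 2 := div_pos hmsq hL2pos
    have hm2cap : msq / (L : ℝ) ^ 2 ≤ m0sq := by
      have h1 : (1 : ℝ) ≤ (L : ℝ) ^ 2 := one_le_pow₀ hL1r
      exact (div_le_self hmsq.le h1).trans hcap
    have hM' : ∀ μ, ksU L i μ = 2 * L ^ (e + 1) := fun μ => by
      show L * (2 * L ^ e) = 2 * L ^ (e + 1)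
      ring
    -- the weight rate one level down
    have hδL0 : 0 ≤ δ' / L := div_nonneg hδ0 hL0.le
    have hδL1 : δ' / L ≤ δ₁ := (div_le_self hδ0 hL1r).trans hδ1
    have hδLκ : δ' / L ≤ κ / 2 := hδL1.trans hδ₁κ
    -- the two block distances of a pair `(x, y)` and the weight under the peel
    have hwt : ∀ y : Tor (fine (L ^ K) (ksU L i)),
        Real.exp (δ' * tdistT (fun _ : Fin (d + 1) => 2 * L ^ e)
          (blockOf (L ^ (K + 1)) (fun _ : Fin (d + 1) => 2 * L ^ e) (flatten (L ^ K) L (ksM L i) x))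
          (blockOf (L ^ (K + 1)) (fun _ : Fin (d + 1) => 2 * L ^ e) (flatten (L ^ K) L (ksM L i) y)))
        ≤ Real.exp δ₁ * Real.exp (δ' / L * tdistT (ksU L i) (blockOf (L ^ K) (ksU L i) x) (blockOf (L ^ K) (ksU L i) y)) := by
      intro y
      rw [← Real.exp_add]
      apply Real.exp_le_exp.mpr
      have hBx : blockOf (L ^ (K + 1)) (fun _ : Fin (d + 1) => 2 * L ^ e) (flatten (L ^ K) L (ksM L i) x)
          = blockOf L (ksM L i) (blockOf (L ^ K) (ksU L i) x) := blockOf_flatten (L ^ K) L (ksM L i) x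
      have hBy : blockOf (L ^ (K + 1)) (fun _ : Fin (d + 1) => 2 * L ^ e) (flatten (L ^ K) L (ksM L i) y)
          = blockOf L (ksM L i) (blockOf (L ^ K) (ksU L i) y) := blockOf_flatten (L ^ K) L (ksM L i) y
      have hgrow : (L : ℝ) * tdistT (fun _ : Fin (d + 1) => 2 * L ^ e)
          (blockOf (L ^ (K + 1)) (fun _ : Fin (d + 1) => 2 * L ^ e) (flatten (L ^ K) L (ksM L i) x))
          (blockOf (L ^ (K + 1)) (fun _ : Fin (d + 1) => 2 * L ^ e) (flatten (L ^ K) L (ksM L i) y))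
          ≤ tdistT (ksU L i) (blockOf (L ^ K) (ksU L i) x) (blockOf (L ^ K) (ksU L i) y) + ((L : ℝ) - 1) := by
        rw [hBx, hBy]
        exact mul_tdistT_blockOf_le L (ksM L i) (blockOf (L ^ K) (ksU L i) x) (blockOf (L ^ K) (ksU L i) y)
      have h := weight_peel_le hL1r hδ0 hδ1 hgrow
      linarith
    -- the induction hypothesis at the weight rate `δ′∕L` on the finer cube
    have hIH : (((L ^ K : ℕ) : ℝ) ^ (d + 1))⁻¹ *
          ∑ y, |constrainedProp (L ^ K) (ksU L i) (aK a L K) (((L ^ K : ℕ) : ℝ) ^ 2) (msq / (L : ℝ) ^ 2) x y|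
            * Real.exp (δ' / L * tdistT (ksU L i) (blockOf (L ^ K) (ksU L i) x) (blockOf (L ^ K) (ksU L i) y)) ≤ C :=
      IH (δ' / L) hδL0 hδL1 (L ^ K) rfl (e + 1) (ksU L i) hM' (msq / (L : ℝ) ^ 2) hm2 hm2cap x
    -- the weighted slice mass: weight rate `≤ κ∕2` against the slice decay `κ`
    have hS : (((L ^ K : ℕ) : ℝ) ^ (d + 1))⁻¹ *
          ∑ y, |ksSlice L a (msq / (L : ℝ) ^ 2) i x y
            * Real.exp (δ' / L * tdistT (ksU L i) (blockOf (L ^ K) (ksU L i) x) (blockOf (L ^ K) (ksU L i) y))|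
        ≤ Cs * latticeConst (d + 1) (κ / 2) :=
      riemannSum_le_of_decay (L ^ K) (ksU L i) (half_pos hκ) hCs.le (blockOf (L ^ K) (ksU L i) x) fun y =>
        abs_mul_exp_le_of_decay hCs.le hδLκ (tdistT_nonneg _ _ _) ((Hs (msq / (L : ℝ) ^ 2) hm2 hm2cap i).1 x y)
    have hNK : (0 : ℝ) < ((L ^ K : ℕ) : ℝ) ^ (d + 1) := by positivity
    have hcast : (((L ^ (K + 1) : ℕ) : ℝ)) ^ (d + 1) = (L : ℝ) ^ (d + 1) * ((L ^ K : ℕ) : ℝ) ^ (d + 1) := by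
      push_cast; ring
    -- abbreviate the weighted summands
    set W : Tor (fine (L ^ K) (ksU L i)) → ℝ := fun y =>
      Real.exp (δ' / L * tdistT (ksU L i) (blockOf (L ^ K) (ksU L i) x) (blockOf (L ^ K) (ksU L i) y)) with hWdef
    have hW0 : ∀ y, 0 ≤ W y := fun y => (Real.exp_pos _).le
    have hsum : ∑ y', |constrainedProp (L ^ (K + 1)) (fun _ : Fin (d + 1) => 2 * L ^ e) (aK a L (K + 1))
          (((L ^ (K + 1) : ℕ) : ℝ) ^ 2) msq (flatten (L ^ K) L (ksM L i) x) y'|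
          * Real.exp (δ' * tdistT (fun _ : Fin (d + 1) => 2 * L ^ e)
            (blockOf (L ^ (K + 1)) (fun _ : Fin (d + 1) => 2 * L ^ e) (flatten (L ^ K) L (ksM L i) x))
            (blockOf (L ^ (K + 1)) (fun _ : Fin (d + 1) => 2 * L ^ e) y'))
        = ∑ y, |constrainedProp (L ^ K * L) (ksM L i) (aK a L (K + 1)) (((L ^ K * L : ℕ) : ℝ) ^ 2) msq
            (flatten (L ^ K) L (ksM L i) x) (flatten (L ^ K) L (ksM L i) y)|
          * Real.exp (δ' * tdistT (fun _ : Fin (d + 1) => 2 * L ^ e)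
            (blockOf (L ^ (K + 1)) (fun _ : Fin (d + 1) => 2 * L ^ e) (flatten (L ^ K) L (ksM L i) x))
            (blockOf (L ^ (K + 1)) (fun _ : Fin (d + 1) => 2 * L ^ e) (flatten (L ^ K) L (ksM L i) y))) :=
      (Fintype.sum_equiv (flatten (L ^ K) L (ksM L i)) _ _ fun y => rfl).symm
    have hterm : ∀ y, |constrainedProp (L ^ K * L) (ksM L i) (aK a L (K + 1)) (((L ^ K * L : ℕ) : ℝ) ^ 2) msq
            (flatten (L ^ K) L (ksM L i) x) (flatten (L ^ K) L (ksM L i) y)|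
          * Real.exp (δ' * tdistT (fun _ : Fin (d + 1) => 2 * L ^ e)
            (blockOf (L ^ (K + 1)) (fun _ : Fin (d + 1) => 2 * L ^ e) (flatten (L ^ K) L (ksM L i) x))
            (blockOf (L ^ (K + 1)) (fun _ : Fin (d + 1) => 2 * L ^ e) (flatten (L ^ K) L (ksM L i) y)))
        ≤ (L : ℝ) ^ (d + 1) / (L : ℝ) ^ 2 * Real.exp δ₁ *
          (|constrainedProp (L ^ K) (ksU L i) (aK a L K) (((L ^ K : ℕ) : ℝ) ^ 2) (msq / (L : ℝ) ^ 2) x y| * W y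
            + |ksSlice L a (msq / (L : ℝ) ^ 2) i x y * W y|) := by
      intro y
      have hp := fullProp_peel_abs_le L hL ha hmsq i x y
      have hSW : |ksSlice L a (msq / (L : ℝ) ^ 2) i x y * W y| = |ksSlice L a (msq / (L : ℝ) ^ 2) i x y| * W y := by
        rw [abs_mul, abs_of_nonneg (hW0 y)]
      rw [hSW]
      calc _ ≤ (L : ℝ) ^ (d + 1) / (L : ℝ) ^ 2 *
            (|constrainedProp (L ^ K) (ksU L i) (aK a L K) (((L ^ K : ℕ) : ℝ) ^ 2) (msq / (L : ℝ) ^ 2) x y|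
              + |ksSlice L a (msq / (L : ℝ) ^ 2) i x y|) * (Real.exp δ₁ * W y) :=
            mul_le_mul hp (hwt y) (Real.exp_pos _).le (by positivity)
        _ = _ := by ring
    calc (((L ^ (K + 1) : ℕ) : ℝ) ^ (d + 1))⁻¹ * ∑ y', |constrainedProp (L ^ (K + 1)) (fun _ : Fin (d + 1) => 2 * L ^ e)
            (aK a L (K + 1)) (((L ^ (K + 1) : ℕ) : ℝ) ^ 2) msq (flatten (L ^ K) L (ksM L i) x) y'|
            * Real.exp (δ' * tdistT (fun _ : Fin (d + 1) => 2 * L ^ e)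
              (blockOf (L ^ (K + 1)) (fun _ : Fin (d + 1) => 2 * L ^ e) (flatten (L ^ K) L (ksM L i) x))
              (blockOf (L ^ (K + 1)) (fun _ : Fin (d + 1) => 2 * L ^ e) y'))
        ≤ (((L ^ (K + 1) : ℕ) : ℝ) ^ (d + 1))⁻¹ * ∑ y, (L : ℝ) ^ (d + 1) / (L : ℝ) ^ 2 * Real.exp δ₁ *
            (|constrainedProp (L ^ K) (ksU L i) (aK a L K) (((L ^ K : ℕ) : ℝ) ^ 2) (msq / (L : ℝ) ^ 2) x y| * W y
              + |ksSlice L a (msq / (L : ℝ) ^ 2) i x y * W y|) := by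
          rw [hsum]
          exact mul_le_mul_of_nonneg_left (sum_le_sum fun y _ => hterm y) (by positivity)
      _ = ((L : ℝ) ^ 2)⁻¹ * Real.exp δ₁ *
            ((((L ^ K : ℕ) : ℝ) ^ (d + 1))⁻¹ *
                ∑ y, |constrainedProp (L ^ K) (ksU L i) (aK a L K) (((L ^ K : ℕ) : ℝ) ^ 2) (msq / (L : ℝ) ^ 2) x y| * W y
              + (((L ^ K : ℕ) : ℝ) ^ (d + 1))⁻¹ * ∑ y, |ksSlice L a (msq / (L : ℝ) ^ 2) i x y * W y|) := by
          rw [hcast, ← mul_sum, sum_add_distrib]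
          field_simp
          ring
      _ ≤ ((L : ℝ) ^ 2)⁻¹ * Real.exp δ₁ * (C + Cs * latticeConst (d + 1) (κ / 2)) :=
          mul_le_mul_of_nonneg_left (add_le_add hIH hS) (by positivity)
      _ ≤ (1 / 3) * (C + Cs * latticeConst (d + 1) (κ / 2)) := by
          refine mul_le_mul_of_nonneg_right ?_ (by positivity)
          have h3 : Real.exp δ₁ ≤ 3 := (Real.exp_le_exp.mpr hδ₁1).trans (by have := Real.exp_one_lt_d9; linarith)
          have h9 : ((L : ℝ) ^ 2)⁻¹ ≤ 1 / 9 := by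
            rw [one_div]; exact inv_anti₀ (by norm_num) hL9
          calc ((L : ℝ) ^ 2)⁻¹ * Real.exp δ₁ ≤ (1 / 9) * 3 :=
                mul_le_mul h9 h3 (Real.exp_pos _).le (by norm_num)
            _ = 1 / 3 := by norm_num
      _ ≤ C := by rw [hCdef]; nlinarith [mul_nonneg hCs.le hKκ, hB₀]

end MassW

end Summit.QuantumFields.YangMills.BalabanUVNodes.N15.KingModel

end
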